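import Literature.MathematicalPhysics.KineticTheory.FluctuationSpace
import Literature.MathematicalPhysics.KineticTheory.FluctuationSpaceStone
import Literature.MathematicalPhysics.KineticTheory.HardSphereGasFluctuations
import Literature.MathematicalPhysics.KineticTheory.RegularStationaryState
import Literature.Analysis.FluidPDE.InfiniteHardSphereFlow
import Literature.Analysis.FluidPDE.InfiniteHardSphereKoopman
import HarnessLib

/-!
# `OneBodyCompleteness` · line `registered` (skeleton v5), stub `stub_fluctuationPackagingUnit`:
# reduction of the unit-diameter dynamical packaging to its three infinite-volume inputs

Support file for the crux item stmt-AtomisticToContinuum-9583 (`OneBodyCompleteness`, route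
`MourreKoopmanCharges` of `AtomisticToContinuum/HydrodynamicLimit`), serving the registered stub
`stub_fluctuationPackagingUnit` (DYNAMICAL PACKAGING, v5 dynamic half of support item 9702 (1)):

  `∃ σ₃ > 0, ∀ σ ∈ (0, σ₃), ∀ z ∈ (0, 2σ³], ∀ G, IsHardSphereGibbs 1 z 1 0 G → IsTranslationInvariant G →`
  `PointProcess.density G = ofReal σ³ → ∃ F : HardSphereFluctuationData 1, F.μ = G ∧`
  `(∃ Φ, Φ.IsEquilibriumFlow ∧ ∀ t, F.flow t =ᵐ[F.μ] Φ.flow t) ∧ (∀ ψ, Continuous (t ↦ F.koopman t ψ)) ∧`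
  `(∀ g continuous polynomially bounded, cellObs g ∈ F.localObs)`.

The stub is NOT closed here: Alexander's theorem `InfiniteHardSphereFlow.nonempty` is an unproved
named fact of the tree, and no space-time clustering theorem for the dilute hard-sphere gas
(`IsLocalObservableSpace Φ G (hardSphereObs Φ)`, `HardSphereGasFluctuations.lean` "What is NOT here")
nor a dynamical-continuity theorem exists (Spohn 1991 Part I Condition 2.1 is an ASSUMPTION in
print). What this file proves is the kernel-checked REDUCTION `fluctuationPackagingUnit_of` of the
exact stub signature to three inputs typed over tree carriers at UNIT diameter:

* (H2) Alexander's theorem BY NAME, `InfiniteHardSphereFlow.nonempty (d := Fin 3)` (an equilibrium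
  flow at every diameter: a.e. defined and stationary for every Gibbs state);
* (H3) almost-sure commutation of every unit-diameter equilibrium flow with the spatial translations
  under every Gibbs state (Alexander 1976 Cor 5.4 with the translation covariance of the DLR
  specification and of `Tᵗ = lim_r T_rᵗ`);
* (H4) below a reduced-diameter threshold `σ₃`: for every unit-diameter equilibrium flow `Φ` and every
  translation-invariant Gibbs state `G` at `(1, z, 1, 0)`, `z ≤ 2σ³`, of density `σ³`, admissibility
  of the canonical observable space (`IsLocalObservableSpace Φ G (hardSphereObs Φ)`: square
  integrability, space-summable truncated correlations of time-evolved local polynomial observables,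
  non-negative structure factor — Spohn 1991 Part I §7.1 Condition 2.1; Doyon 2022 Def. 4.3–4.4)
  together with dynamical continuity at `t = 0` of `t ↦ ∫ Cov_G(a, a ∘ Φ_t ∘ τ_x) dx` on
  `hardSphereObs Φ` (Doyon 2022 Def. 4.8 / Thm 4.11 (III)) — exactly the two things the tree's
  packaging `InfiniteHardSphereFlow.fluctuationData` and
  `FluctuationDynamics.isStronglyContinuous_of_continuousAt_form` consume.

Proved here: the fixed-parameter assembly `exists_packaging_of_ae` (`F := Φ.fluctuationData ⟨G,
hardSphereObs Φ, …⟩`, so `F.μ = G` and `F.flow = Φ.flow` definitionally; strong continuity of the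
Koopman group from dynamical continuity of the form; one-body cell observables are local polynomial
observables, `cellObs_mem_hardSphereObs`), and the threshold bookkeeping `fluctuationPackagingUnit_of`,
following the sibling reduction `Theorems.MourreKoopmanChargesStressStrongMixing.stressFramework_of`.

References: H. Spohn, *Large Scale Dynamics of Interacting Particles* (1991), Part I §7.1 (7.4)–(7.7),
Condition 2.1; R. Alexander, Comm. Math. Phys. 49 (1976), Thm 5.2, Cor 5.4; B. Doyon, Comm. Math.
Phys. 391 (2022), Def. 4.3–4.4, 4.8, Thm 4.11.
-/

noncomputable section

open MeasureTheory ProbabilityTheory Filter Topology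
open scoped InnerProductSpace ENNReal

namespace Summit.AtomisticToContinuum.HydrodynamicLimit.Theorems.MourreKoopmanChargesOneBodyCompleteness

open Literature.MathematicalPhysics.KineticTheory Literature.Analysis.FluidPDE
open Literature.Analysis.FunctionSpaces (PointConfig)

/-! ### One-body cell observables are admissible -/

/-- One-body cell observables `A_g = Σ_{q ∈ [0,1)³} g(v)` with continuous polynomially bounded
profile `g` are local polynomial observables, hence lie in `hardSphereObs Φ` (the flow–shift span of
the local polynomial observables) for every infinite hard-sphere flow `Φ`. [folklore] -/
theorem cellObs_mem_hardSphereObs {ε : ℝ} (Φ : InfiniteHardSphereFlow (Fin 3) ε) {g : V3 → ℝ}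
    (hg : Continuous g) (hb : ∃ (C : ℝ) (k : ℕ), ∀ v, |g v| ≤ C * (1 + ‖v‖) ^ k) :
    cellObs g ∈ hardSphereObs Φ :=
  mem_hardSphereObs_of_isLocalPolyObs Φ (isLocalPolyObs_cellObs hg.measurable hb)

/-! ### Assembly of the packaging at fixed parameters -/

/-- **The dynamical packaging at fixed parameters, almost-everywhere form.** Given a
translation-invariant Gibbs state `G` of the hard-sphere gas of diameter `ε` at activity `z > 0`,
inverse temperature `β > 0`, zero drift; an equilibrium flow `Φ` (a.e. defined and stationary for
every Gibbs state) commuting with the spatial translations `G`-almost everywhere; admissibility of the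
canonical observable space `hardSphereObs Φ` for `(Φ, G)`; and continuity at `t = 0` of the
space-integrated autocorrelations `t ↦ ∫ Cov_G(a, a ∘ Φ_t ∘ τ_x) dx`, `a ∈ hardSphereObs Φ` — the data
`F := Φ.fluctuationData ⟨G, hardSphereObs Φ, …⟩` has state `G` (definitionally), is carried by `Φ`,
has a strongly continuous Koopman group (`FluctuationDynamics.isStronglyContinuous_of_continuousAt_form`:
isometries, continuity at `0` on the dense classes, group law) and contains every one-body cell
observable with continuous polynomially bounded profile. [folklore] -/
theorem exists_packaging_of_ae {ε z β : ℝ} (hz : 0 < z) (hβ : 0 < β)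
    {G : Measure MarkedConfig} (hG : IsHardSphereGibbs ε z β (0 : V3) G)
    (hti : IsTranslationInvariant G)
    {Φ : InfiniteHardSphereFlow (Fin 3) ε} (hΦ : Φ.IsEquilibriumFlow)
    (hcomm : ∀ (t : ℝ) (x : V3), Φ.flow t ∘ spatialShift x =ᵐ[G] spatialShift x ∘ Φ.flow t)
    (h𝒱 : IsLocalObservableSpace Φ G (hardSphereObs Φ))
    (hcont : ∀ ⦃a : MarkedConfig → ℝ⦄, a ∈ hardSphereObs Φ →
      ContinuousAt (fun t : ℝ => ∫ x : V3, cov[a, (a ∘ Φ.flow t) ∘ spatialShift x; G]) 0) :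
    ∃ F : HardSphereFluctuationData ε,
      F.μ = G ∧
      (∃ Φ : InfiniteHardSphereFlow (Fin 3) ε, Φ.IsEquilibriumFlow ∧ ∀ t : ℝ, F.flow t =ᵐ[F.μ] Φ.flow t) ∧
      (∀ ψ : HardSphereFluctuationSpace F, Continuous fun t : ℝ => F.koopman t ψ) ∧
      (∀ g : V3 → ℝ, Continuous g → (∃ (C : ℝ) (k : ℕ), ∀ v, |g v| ≤ C * (1 + ‖v‖) ^ k) →
        cellObs g ∈ F.localObs) := by
  -- the static fluctuation structure of `(G, hardSphereObs Φ)`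
  let S : FluctuationStructure (volume : Measure V3) spatialShift :=
    { μ := G
      isProbabilityMeasure := hG.1
      measurePreserving_shift := fun x => ⟨PointConfig.measurable_translate _, hti x⟩
      localObs := hardSphereObs Φ
      memLp_of_mem := h𝒱.memLp
      comp_shift_mem := h𝒱.comp_shift_mem
      integrable_cov := h𝒱.integrable_cov
      form_self_nonneg := h𝒱.form_self_nonneg }
  have hP : Φ.IsAEDefined S.μ := hΦ.isAEDefined hz hβ hG
  have hS : Φ.IsStationary S.μ := hΦ.isStationary hz hβ hG
  refine ⟨Φ.fluctuationData S hP hS hcomm h𝒱.comp_flow_mem h𝒱.cellCharge_mem, rfl,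
    ⟨Φ, hΦ, fun t => Filter.EventuallyEq.rfl⟩, ?_, ?_⟩
  · -- strong continuity of the Koopman group from dynamical continuity of the form
    exact (Φ.fluctuationData S hP hS hcomm h𝒱.comp_flow_mem
      h𝒱.cellCharge_mem).toFluctuationDynamics.isStronglyContinuous_of_continuousAt_form
        fun a ha => hcont ha
  · -- admissibility of `A_g`
    intro g hg hb
    exact cellObs_mem_hardSphereObs Φ hg hb

/-! ### The reduction of the stub to named-fact-shaped infinite-volume inputs -/

/-- **Stub `stub_fluctuationPackagingUnit` from its infinite-volume inputs** (REDUCTION; the stub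
itself is not closed). (H2) Alexander's theorem BY NAME, `InfiniteHardSphereFlow.nonempty (d := Fin 3)`
(Alexander 1976 Thm 5.2: an equilibrium flow at every diameter, here used at diameter `1`);
(H3) almost-sure commutation of unit-diameter equilibrium flows with the spatial translations under
every Gibbs state (Alexander 1976 Cor 5.4 with the translation covariance of the specification);
(H4) below a reduced-diameter threshold `σ₃`, for every unit-diameter equilibrium flow `Φ`, every
activity `z ≤ 2σ³` and every translation-invariant Gibbs state `G` at `(1, z, 1, 0)` of density `σ³`:
admissibility `IsLocalObservableSpace Φ G (hardSphereObs Φ)` (space-summable truncated correlations of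
time-evolved local polynomial observables, non-negative structure factor; Spohn 1991 Part I §7.1
Condition 2.1 — an assumption in print) and dynamical continuity at `t = 0` of
`t ↦ ∫ Cov_G(a, a ∘ Φ_t ∘ τ_x) dx` on `hardSphereObs Φ` (Doyon 2022 Def. 4.8 / Thm 4.11 (III)).
The threshold of the stub is `σ₃` itself; the flow is Alexander's flow at diameter `1`, chosen once.
[folklore] -/
theorem fluctuationPackagingUnit_of :
    Literature.Analysis.FluidPDE.InfiniteHardSphereFlow.nonempty (d := Fin 3) →
    (∀ Φ : Literature.Analysis.FluidPDE.InfiniteHardSphereFlow (Fin 3) 1, Φ.IsEquilibriumFlow →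
      ∀ z β : ℝ, 0 < z → 0 < β →
      ∀ μ : MeasureTheory.Measure Literature.MathematicalPhysics.KineticTheory.MarkedConfig,
        Literature.Analysis.FluidPDE.IsHardSphereGibbs 1 z β
          (0 : Literature.MathematicalPhysics.KineticTheory.V3) μ →
        ∀ (t : ℝ) (x : Literature.MathematicalPhysics.KineticTheory.V3),
          Φ.flow t ∘ Literature.MathematicalPhysics.KineticTheory.spatialShift x =ᵐ[μ]
            Literature.MathematicalPhysics.KineticTheory.spatialShift x ∘ Φ.flow t) →
    (∃ σ₃ : ℝ, 0 < σ₃ ∧ ∀ σ : ℝ, 0 < σ → σ < σ₃ →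
      ∀ Φ : Literature.Analysis.FluidPDE.InfiniteHardSphereFlow (Fin 3) 1, Φ.IsEquilibriumFlow →
      ∀ z : ℝ, 0 < z → z ≤ 2 * σ ^ 3 →
      ∀ G : MeasureTheory.Measure Literature.MathematicalPhysics.KineticTheory.MarkedConfig,
        Literature.Analysis.FluidPDE.IsHardSphereGibbs 1 z 1
          (0 : Literature.MathematicalPhysics.KineticTheory.V3) G →
        Literature.Analysis.FluidPDE.IsTranslationInvariant G →
        Literature.MathematicalPhysics.KineticTheory.PointProcess.density G = ENNReal.ofReal (σ ^ 3) →
        Literature.MathematicalPhysics.KineticTheory.IsLocalObservableSpace Φ G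
            (Literature.MathematicalPhysics.KineticTheory.hardSphereObs Φ) ∧
          (∀ ⦃a : Literature.MathematicalPhysics.KineticTheory.MarkedConfig → ℝ⦄,
            a ∈ Literature.MathematicalPhysics.KineticTheory.hardSphereObs Φ →
            ContinuousAt (fun t : ℝ => ∫ x : Literature.MathematicalPhysics.KineticTheory.V3,
              cov[a, (a ∘ Φ.flow t) ∘ Literature.MathematicalPhysics.KineticTheory.spatialShift x; G]) 0)) →
    ∃ σ₃ : ℝ, 0 < σ₃ ∧ ∀ σ : ℝ, 0 < σ → σ < σ₃ → ∀ z : ℝ, 0 < z → z ≤ 2 * σ ^ 3 →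
      ∀ G : MeasureTheory.Measure Literature.MathematicalPhysics.KineticTheory.MarkedConfig,
        Literature.Analysis.FluidPDE.IsHardSphereGibbs 1 z 1
          (0 : Literature.MathematicalPhysics.KineticTheory.V3) G →
        Literature.Analysis.FluidPDE.IsTranslationInvariant G →
        Literature.MathematicalPhysics.KineticTheory.PointProcess.density G = ENNReal.ofReal (σ ^ 3) →
        ∃ F : Literature.MathematicalPhysics.KineticTheory.HardSphereFluctuationData 1,
          F.μ = G ∧
          (∃ Φ : Literature.Analysis.FluidPDE.InfiniteHardSphereFlow (Fin 3) 1,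
            Φ.IsEquilibriumFlow ∧ ∀ t : ℝ, F.flow t =ᵐ[F.μ] Φ.flow t) ∧
          (∀ ψ : Literature.MathematicalPhysics.KineticTheory.HardSphereFluctuationSpace F,
            Continuous fun t : ℝ => F.koopman t ψ) ∧
          (∀ g : Literature.MathematicalPhysics.KineticTheory.V3 → ℝ, Continuous g →
            (∃ (C : ℝ) (k : ℕ), ∀ v, |g v| ≤ C * (1 + ‖v‖) ^ k) →
            Literature.MathematicalPhysics.KineticTheory.cellObs g ∈ F.localObs) := by
  intro hH2 hH3 hH4
  obtain ⟨σ₃, hσ₃, H₄⟩ := hH4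
  -- Alexander's flow at unit diameter, chosen once
  obtain ⟨Φ, hΦ⟩ := hH2 (zero_lt_one' ℝ)
  refine ⟨σ₃, hσ₃, ?_⟩
  intro σ hσ hσlt z hz hzle G hG hti hρ
  obtain ⟨h𝒱, hcont⟩ := H₄ σ hσ hσlt Φ hΦ z hz hzle G hG hti hρ
  exact exists_packaging_of_ae hz one_pos hG hti hΦ (hH3 Φ hΦ z 1 hz one_pos G hG) h𝒱 hcont

end Summit.AtomisticToContinuum.HydrodynamicLimit.Theorems.MourreKoopmanChargesOneBodyCompleteness

end
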